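import Summits.Ventures.HodgeRepro.RectQuadOdd

/-!
# The two-generator rectangle for every `k ≥ 3`: `{1, w₁c, w₂c, w₁w₂}` with `⟨w₁, w₂⟩ ≅ ℤ/k × ℤ/k`

Blind re-derivation cell `pub-hodge-repro`, seat `p1` (gen 10).  The general level of `RectQuad33.lean`: for every
finite `(G, c)` and every injective hom `ψ : ℤ/2 × ℤ/k × ℤ/k →* G` with `ψ (1,0,0) = c` and ANY `k ≥ 3`, if
`4k² ≤ |G|` then some CM type `Φ` has the twists by `ψ (1,1,0), ψ (1,0,1), ψ (0,1,1)` — i.e. `w₁c, w₂c, w₁w₂` for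
`w₁ = ψ (0,1,0)`, `w₂ = ψ (0,0,1)` — `SumTwo` without a conjugate pair (`exists_rectQuad_kk`).  (For even `k`
such an embedding needs a `2`-part of `2`-rank `≥ 3`, where the coset mechanisms already apply; the case of interest
is `k` odd — a second mechanism on groups with a unique involution.)

The two local solutions on `W = ℤ/2 × ℤ/k × ℤ/k` are again the CM types INDUCED from the two quotients `W/⟨w₂⟩`
and `W/⟨w₁⟩`: type A `[s = 0] ⟺ [a = 0]`, type B `[s = 0] ⟺ [b = 0]`.  For a type depending on `(s, a)` only,
`SumTwo` for the rectangle `(u, v) = (w₁c, w₂c)` is automatic (`f(x) + f(x u⁻¹) = 1` and `f(x v⁻¹) + f(x (uv)⁻¹) = 1`),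
and the bad translates are: `v` (the type ignores `b`), but NOT `u` (the trace `{a = 0}` is not shift-invariant),
and NOT `uv`, `u v⁻¹` (a shift-invariant-up-to-complement trace would be alternating, and `{a = 0}` is not, for any
`k ≥ 3`: `1 ≠ 0`, `2 ≠ 0` in `ℤ/k` at the explicit witnesses) — so the two types have the disjoint bad sets `{v}`
and `{u}` and two cosets of `W` suffice.  `k` odd is only needed for the injectivity argument of an ELEMENT form
(`(cˢ w₁ᵃ w₂ᵇ)ᵏ = cˢ`; see `rectHom33_injective` for `k = 3`), not formalised here beyond `k = 3`.

Predicted by the same Fourier argument as §16d for `G = C_{2^a} × O` with `O` of `p`-rank `≥ 2`; census control: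
`(C₅ × C₁₀, (0,5))` EMPTY (order `50 < 100`), `(C₅ × C₂₀, (0,10))` at order `100` = the first `k = 5` instance.
-/

set_option autoImplicit false

open Finset
open scoped Pointwise

namespace HodgeRepro.CosetQuad

variable {G : Type*} [Group G]

/-- Exactly two of `b, ¬b', ¬b, b'` hold. -/
theorem card_filter_vecC (b₀ b₂ : Bool) :
    (univ.filter fun j : Fin 4 => ![b₀, !b₂, !b₀, b₂] j = true).card = 2 := by
  cases b₀ <;> cases b₂ <;> decide

section RectKK

variable (k : ℕ) [NeZero k]

/-- The abstract group `ℤ/2 × ℤ/k × ℤ/k` of the two-generator rectangle mechanism. -/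
abbrev PKK : Type := Multiplicative (ZMod 2) × (Multiplicative (ZMod k) × Multiplicative (ZMod k))

/-- The twists `1, (1,1,0), (1,0,1), (0,1,1)`, mapped to `1, w₁c, w₂c, w₁w₂`. -/
def twistKK (i : Fin 4) : PKK k :=
  ![(1, 1, 1), (Multiplicative.ofAdd 1, Multiplicative.ofAdd 1, 1),
    (Multiplicative.ofAdd 1, 1, Multiplicative.ofAdd 1), (1, Multiplicative.ofAdd 1, Multiplicative.ofAdd 1)] i

/-- The element `(1, 0, 0)` of `PKK k`, mapped to `c`. -/
def conjKK : PKK k := (Multiplicative.ofAdd 1, 1, 1)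

/-- The two induced local solutions as a pattern: label `0` (type A) `[s = 0] ⟺ [a = 0]`, label `1` (type B)
`[s = 0] ⟺ [b = 0]`. -/
def patternKK (l : Fin 2) (p : PKK k) : Bool :=
  if l = 0 then decide (Multiplicative.toAdd p.1 = 0) == decide (Multiplicative.toAdd p.2.1 = 0)
  else decide (Multiplicative.toAdd p.1 = 0) == decide (Multiplicative.toAdd p.2.2 = 0)

omit [NeZero k] in
/-- Type A at a point. -/
theorem patternKK_zero (s : Multiplicative (ZMod 2)) (a b : Multiplicative (ZMod k)) :
    patternKK k 0 (s, a, b) =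
      (decide (Multiplicative.toAdd s = 0) == decide (Multiplicative.toAdd a = 0)) := by
  simp [patternKK]

omit [NeZero k] in
/-- Type B at a point. -/
theorem patternKK_one (s : Multiplicative (ZMod 2)) (a b : Multiplicative (ZMod k)) :
    patternKK k 1 (s, a, b) =
      (decide (Multiplicative.toAdd s = 0) == decide (Multiplicative.toAdd b = 0)) := by
  simp [patternKK]

/-- `[x + 1 = 0] = ¬[x = 0]` in `ℤ/2`. -/
theorem zmod2_add_one_zero (x : ZMod 2) : decide (x + 1 = 0) = !decide (x = 0) := by
  revert x; decide

/-- `[x + (-1) = 0] = ¬[x = 0]` in `ℤ/2`. -/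
theorem zmod2_add_neg_one_zero (x : ZMod 2) : decide (x + -1 = 0) = !decide (x = 0) := by
  revert x; decide

omit [NeZero k] in
/-- The CM condition of both patterns: multiplying by `conjKK = (1, 0, 0)` flips the value. -/
theorem patternKK_conj (l : Fin 2) (p : PKK k) : patternKK k l (p * conjKK k) = !patternKK k l p := by
  rcases p with ⟨s, a, b⟩
  have hx : ∀ X Y : Bool, ((!X) == Y) = !(X == Y) := by decide
  fin_cases l
  · show patternKK k 0 (s * Multiplicative.ofAdd 1, a * 1, b * 1) = !patternKK k 0 (s, a, b)
    rw [mul_one, mul_one, patternKK_zero, patternKK_zero, toAdd_mul, toAdd_ofAdd, zmod2_add_one_zero, hx]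
  · show patternKK k 1 (s * Multiplicative.ofAdd 1, a * 1, b * 1) = !patternKK k 1 (s, a, b)
    rw [mul_one, mul_one, patternKK_one, patternKK_one, toAdd_mul, toAdd_ofAdd, zmod2_add_one_zero, hx]

omit [NeZero k] in
/-- The four translates `p (t j)⁻¹`, `j = 0, 1, 2, 3`, written out. -/
theorem mul_twistKK_inv (s : Multiplicative (ZMod 2)) (a b : Multiplicative (ZMod k)) :
    ((s, a, b) * (twistKK k 0)⁻¹ = (s, a, b)) ∧
    ((s, a, b) * (twistKK k 1)⁻¹ = (s * Multiplicative.ofAdd (-1), a * Multiplicative.ofAdd (-1), b)) ∧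
    ((s, a, b) * (twistKK k 2)⁻¹ = (s * Multiplicative.ofAdd (-1), a, b * Multiplicative.ofAdd (-1))) ∧
    ((s, a, b) * (twistKK k 3)⁻¹ = (s, a * Multiplicative.ofAdd (-1), b * Multiplicative.ofAdd (-1))) := by
  refine ⟨?_, ?_, ?_, ?_⟩
  · show (s, a, b) * (1, 1, 1)⁻¹ = (s, a, b)
    simp only [Prod.inv_mk, inv_one, Prod.mk_mul_mk, mul_one]
  · show (s, a, b) * (Multiplicative.ofAdd 1, Multiplicative.ofAdd 1, 1)⁻¹ =
      (s * Multiplicative.ofAdd (-1), a * Multiplicative.ofAdd (-1), b)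
    simp only [Prod.inv_mk, inv_one, Prod.mk_mul_mk, mul_one, ofAdd_neg]
  · show (s, a, b) * (Multiplicative.ofAdd 1, 1, Multiplicative.ofAdd 1)⁻¹ =
      (s * Multiplicative.ofAdd (-1), a, b * Multiplicative.ofAdd (-1))
    simp only [Prod.inv_mk, inv_one, Prod.mk_mul_mk, mul_one, ofAdd_neg]
  · show (s, a, b) * (1, Multiplicative.ofAdd 1, Multiplicative.ofAdd 1)⁻¹ =
      (s, a * Multiplicative.ofAdd (-1), b * Multiplicative.ofAdd (-1))
    simp only [Prod.inv_mk, inv_one, Prod.mk_mul_mk, mul_one, ofAdd_neg]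

omit [NeZero k] in
/-- `SumTwo` of both patterns: the four translates carry `b₀, ¬b₀, b₂, ¬b₂` (type A: the `s`-flip negates on
translates 1 and 2 relative to 0 and 3) resp. the same for type B. -/
theorem patternKK_card (l : Fin 2) (p : PKK k) :
    (univ.filter fun j : Fin 4 => patternKK k l (p * (twistKK k j)⁻¹) = true).card = 2 := by
  rcases p with ⟨s, a, b⟩
  obtain ⟨h0, h1, h2, h3⟩ := mul_twistKK_inv k s a b
  have hx : ∀ X Y : Bool, ((!X) == Y) = !(X == Y) := by decide
  fin_cases l
  · -- type A: values `b₀, ¬b₂, ¬b₀, b₂` with `b₀ = A(s,a)`, `b₂ = A(s, a - 1)`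
    refine Eq.trans ?_ (card_filter_vecC (patternKK k 0 (s, a, b))
      (patternKK k 0 (s, a * Multiplicative.ofAdd (-1), b)))
    congr 1
    apply Finset.filter_congr
    intro j _
    fin_cases j
    · show patternKK k 0 ((s, a, b) * (twistKK k 0)⁻¹) = true ↔ patternKK k 0 (s, a, b) = true
      rw [h0]
    · show patternKK k 0 ((s, a, b) * (twistKK k 1)⁻¹) = true ↔
        (!patternKK k 0 (s, a * Multiplicative.ofAdd (-1), b)) = true
      rw [h1, patternKK_zero, patternKK_zero, toAdd_mul s, toAdd_ofAdd, zmod2_add_neg_one_zero, hx]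
    · show patternKK k 0 ((s, a, b) * (twistKK k 2)⁻¹) = true ↔
        (!patternKK k 0 (s, a, b)) = true
      rw [h2, patternKK_zero, patternKK_zero, toAdd_mul s, toAdd_ofAdd, zmod2_add_neg_one_zero, hx]
    · show patternKK k 0 ((s, a, b) * (twistKK k 3)⁻¹) = true ↔
        patternKK k 0 (s, a * Multiplicative.ofAdd (-1), b) = true
      rw [h3, patternKK_zero, patternKK_zero]
  · -- type B: values `b₀, ¬b₀, ¬b₂, b₂` with `b₀ = B(s,b)`, `b₂ = B(s, b - 1)`
    refine Eq.trans ?_ (card_filter_vecA (patternKK k 1 (s, a, b))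
      (!patternKK k 1 (s, a, b * Multiplicative.ofAdd (-1))))
    congr 1
    apply Finset.filter_congr
    intro j _
    fin_cases j
    · show patternKK k 1 ((s, a, b) * (twistKK k 0)⁻¹) = true ↔ patternKK k 1 (s, a, b) = true
      rw [h0]
    · show patternKK k 1 ((s, a, b) * (twistKK k 1)⁻¹) = true ↔
        (!patternKK k 1 (s, a, b)) = true
      rw [h1, patternKK_one, patternKK_one, toAdd_mul s, toAdd_ofAdd, zmod2_add_neg_one_zero, hx]
    · show patternKK k 1 ((s, a, b) * (twistKK k 2)⁻¹) = true ↔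
        (!patternKK k 1 (s, a, b * Multiplicative.ofAdd (-1))) = true
      rw [h2, patternKK_one, patternKK_one, toAdd_mul s, toAdd_ofAdd, zmod2_add_neg_one_zero, hx]
    · show patternKK k 1 ((s, a, b) * (twistKK k 3)⁻¹) = true ↔
        (!!patternKK k 1 (s, a, b * Multiplicative.ofAdd (-1))) = true
      rw [h3, Bool.not_not, patternKK_one, patternKK_one]

omit [NeZero k] in
/-- No conjugate pair: the six translates `D = t_j · c · t_i⁻¹ ∈ {c, w₁, w₂, w₁w₂, w₁⁻¹w₂, w₁w₂⁻¹} · {1, c}` are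
each broken by one pattern at one point (`c` by the CM condition; `w₁c`, `w₁⁻¹c` by type A at `a = 0`; `w₂c`,
`w₂⁻¹c` by type B at `b = 0`; `w₁w₂`, `w₁⁻¹w₂⁻¹` by type A at `a = 0`, `w₁w₂⁻¹`, `w₁⁻¹w₂` by type A at `a = 0`;
`w₁ w₂ c` … — all with only `1 ≠ 0`, `2 ≠ 0`, `-1 ≠ 0` in `ℤ/k`). -/
theorem patternKK_noConj (hk : 3 ≤ k) : ∀ i j : Fin 4,
    ¬ ∀ (l : Fin 2) (p : PKK k), (patternKK k l (p * (twistKK k j)⁻¹) = true ↔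
      patternKK k l (p * (conjKK k * (twistKK k i)⁻¹)) = true) := by
  obtain ⟨f1, f2, fm1⟩ := zmodk_facts k hk
  have f21 : (2 : ZMod k) + -1 = 1 := by rw [← one_add_one_eq_two, add_neg_cancel_right]
  have z1 : ((1 : ZMod 2) + 1) = 0 := by decide
  have z2 : (-1 : ZMod 2) = 1 := by decide
  have z01 : (0 : ZMod 2) ≠ 1 := by decide
  intro i j h
  have h' : ∀ (l : Fin 2) (q : PKK k), (patternKK k l q = true ↔
      patternKK k l (q * (twistKK k j * (conjKK k * (twistKK k i)⁻¹))) = true) := by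
    intro l q
    have := h l (q * twistKK k j)
    rwa [mul_inv_cancel_right, mul_assoc] at this
  fin_cases i <;> fin_cases j
  · -- (i, j) = (0, 0)
    have := h' 1 (1, 1, 1)
    simp [twistKK, conjKK, patternKK_one] at this
  · -- (i, j) = (0, 1)
    have := h' 0 (1, 1, 1)
    simp [twistKK, conjKK, patternKK_zero, f1, z1] at this
  · -- (i, j) = (0, 2)
    have := h' 1 (1, 1, 1)
    simp [twistKK, conjKK, patternKK_one, f1, z1] at this
  · -- (i, j) = (0, 3)
    have := h' 0 (1, Multiplicative.ofAdd 1, 1)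
    simp [twistKK, conjKK, patternKK_zero, f1, f2, one_add_one_eq_two] at this
  · -- (i, j) = (1, 0)
    have := h' 0 (1, 1, 1)
    simp [twistKK, conjKK, patternKK_zero, fm1] at this
  · -- (i, j) = (1, 1)
    have := h' 1 (1, 1, 1)
    simp [twistKK, conjKK, patternKK_one] at this
  · -- (i, j) = (1, 2)
    have := h' 1 (1, 1, Multiplicative.ofAdd 1)
    simp [twistKK, conjKK, patternKK_one, f1, f2, one_add_one_eq_two] at this
  · -- (i, j) = (1, 3)
    have := h' 1 (1, 1, 1)
    simp [twistKK, conjKK, patternKK_one, f1] at this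
  · -- (i, j) = (2, 0)
    have := h' 1 (1, 1, 1)
    simp [twistKK, conjKK, patternKK_one, fm1] at this
  · -- (i, j) = (2, 1)
    have := h' 0 (1, Multiplicative.ofAdd 1, 1)
    simp [twistKK, conjKK, patternKK_zero, f1, f2, one_add_one_eq_two] at this
  · -- (i, j) = (2, 2)
    have := h' 1 (1, 1, 1)
    simp [twistKK, conjKK, patternKK_one] at this
  · -- (i, j) = (2, 3)
    have := h' 0 (1, 1, 1)
    simp [twistKK, conjKK, patternKK_zero, f1] at this
  · -- (i, j) = (3, 0)
    have := h' 0 (1, Multiplicative.ofAdd (1 + 1), 1)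
    simp [twistKK, conjKK, patternKK_zero, f1, f2, one_add_one_eq_two, f21] at this
  · -- (i, j) = (3, 1)
    have := h' 1 (1, 1, 1)
    simp [twistKK, conjKK, patternKK_one, fm1, z1] at this
  · -- (i, j) = (3, 2)
    have := h' 0 (1, 1, 1)
    simp [twistKK, conjKK, patternKK_zero, fm1, z1] at this
  · -- (i, j) = (3, 3)
    have := h' 1 (1, 1, 1)
    simp [twistKK, conjKK, patternKK_one] at this

/-- **The two-generator rectangle for every `k ≥ 3` exists from degree `4k²` on.**  For every finite
`(G, c)` and every injective hom `ψ : ℤ/2 × ℤ/k × ℤ/k →* G` with `ψ (1,0,0) = c`, `k ≥ 3`: if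
`4k² ≤ |G|`, some CM type `Φ` has the twists by `ψ (1,1,0), ψ (1,0,1), ψ (0,1,1)` (`= w₁c, w₂c, w₁w₂`) `SumTwo`
without a conjugate pair. -/
theorem exists_rectQuad_kk [Fintype G] [DecidableEq G] (ψ : PKK k →* G) (hψ : Function.Injective ψ)
    {c : G} (hc : IsComplexConj c) (hψc : ψ (conjKK k) = c) (hk : 3 ≤ k)
    (hG : 4 * (k * k) ≤ Fintype.card G) :
    ∃ Φ : Finset G, IsCMType c Φ ∧ SumTwo (fun i => rmul Φ (ψ (twistKK k i))) ∧
      ∀ i j : Fin 4, rmul Φ (ψ (twistKK k j)) ≠ c • rmul Φ (ψ (twistKK k i)) := by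
  have hcard : Fintype.card (Fin 2) * Fintype.card (PKK k) ≤ Fintype.card G := by
    rw [Fintype.card_fin, Fintype.card_prod, Fintype.card_prod, Fintype.card_multiplicative,
      Fintype.card_multiplicative, ZMod.card, ZMod.card]
    omega
  exact exists_quad_of_pattern ψ hψ hc hψc (twistKK k) (patternKK k) (patternKK_conj k) (patternKK_card k)
    (patternKK_noConj k hk) hcard

end RectKK

end HodgeRepro.CosetQuad
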